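import Summits.ValiantsHypothesis.ValiantsHypothesis.Theorems.RigidityForcesSymmetryGrenetFirstOrderRankRigidWordEval

/-!
# Route RigidityForcesSymmetry — `GrenetFirstOrderRankRigid` (item stmt-ValiantsHypothesis-21029),
line `grenet_gauge`: stub `stub_linearRigid`, step 5 (block II) — the path matrix at a word point with
ONE EXTRA CELL

For the crux line `Cruxes/GrenetFirstOrderRankRigid/Lines/grenet_gauge.lean` (blueprint
`Lines/grenet_gauge-stub_linearRigid-PROOF.md`, §5, block II).  The designs of the overlap block II
("transversal with one anchored letter") are 0/1 points `x_{p,c} := [r c = p ∨ (c = c⋆ ∧ p = p⋆)]`: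
the graph of a word `r : Fin n → Fin n` plus one extra cell `(p⋆, c⋆)`.  A lattice path surviving at
such a point follows `r` except possibly at the level `c⋆`, where it may insert `p⋆` instead:

* `evalExtra_grenet_adj_pow` — `eval ((adj ^ m) S T) = [the r-path from S of length m is valid and
  ends at T] + [for the (unique) `t⋆` with `|S| + t⋆ = c⋆` and `p⋆ ≠ r c⋆`, the path modified at `t⋆`
  is valid and ends at T]`;
* `evalExtra_grenet_W` — the same for `W S T` (`m = |T| - |S|`).

No new definitions.  VP ≠ VNP is not moved by this file.
-/

noncomputable section

open MvPolynomial Matrix Finset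

namespace Summit.ValiantsHypothesis.Theorems.RigidityForcesSymmetry.GrenetGauge

open Literature.Computability.AlgebraicComplexity

variable (k : Type*) [CommRing k] {n : ℕ}

/-- **Powers of the adjacency matrix at a word point with one extra cell.**  For `|S| + m ≤ n`, at the
point `x_{p,c} := [r c = p ∨ (c = c⋆ ∧ p = p⋆)]` the entry `(adj ^ m) S T` evaluates to the number of
valid paths (injective, avoiding `S`, covering `T \\ S`) among the `r`-path `t ↦ r (|S| + t)` and its
modification inserting `p⋆` at the level `c⋆` (when `|S| ≤ c⋆ < |S| + m` and `p⋆ ≠ r c⋆`). [folklore] -/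
theorem evalExtra_grenet_adj_pow (r : Fin n → Fin n) (p₀ : Fin n) (c₀ : Fin n) {m : ℕ}
    (S T : Finset (Fin n)) (hsm : S.card + m ≤ n) :
    eval (fun v : Fin n × Fin n => if r v.2 = v.1 ∨ (v.2 = c₀ ∧ v.1 = p₀) then (1 : k) else 0)
        ((Grenet.adj k n ^ m) S T)
      = (if Function.Injective (fun t : Fin m => r ⟨S.card + (t : ℕ), by omega⟩) ∧
            (∀ t : Fin m, r ⟨S.card + (t : ℕ), by omega⟩ ∉ S) ∧
            S ∪ univ.image (fun t : Fin m => r ⟨S.card + (t : ℕ), by omega⟩) = T then 1 else 0) +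
        (if ∃ t₀ : Fin m, S.card + (t₀ : ℕ) = c₀ ∧ p₀ ≠ r c₀ ∧
            Function.Injective (Function.update (fun t : Fin m => r ⟨S.card + (t : ℕ), by omega⟩) t₀ p₀) ∧
            (∀ t : Fin m, Function.update (fun t : Fin m => r ⟨S.card + (t : ℕ), by omega⟩) t₀ p₀ t ∉ S) ∧
            S ∪ univ.image (Function.update (fun t : Fin m => r ⟨S.card + (t : ℕ), by omega⟩) t₀ p₀) = T
          then 1 else 0) := by
  classical
  rw [eval_grenet_adj_pow]
  set g₀ : Fin m → Fin n := fun t => r ⟨S.card + (t : ℕ), by omega⟩ with hg₀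
  -- the surviving sequences
  have hfac : ∀ (g : Fin m → Fin n) (t : Fin m),
      eval (fun v : Fin n × Fin n => if r v.2 = v.1 ∨ (v.2 = c₀ ∧ v.1 = p₀) then (1 : k) else 0)
        (Grenet.wt k n (g t) (S.card + t))
      = if g₀ t = g t ∨ (S.card + (t : ℕ) = c₀ ∧ g t = p₀) then 1 else 0 := by
    intro g t
    rw [eval_grenet_wt, dif_pos (by omega)]
    simp only [hg₀, Fin.ext_iff]
  simp_rw [hfac, Fintype.prod_boole]
  by_cases hx : ∃ t₀ : Fin m, S.card + (t₀ : ℕ) = c₀ ∧ p₀ ≠ r c₀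
  · obtain ⟨t₀, ht₀, hp⟩ := hx
    set g₁ : Fin m → Fin n := Function.update g₀ t₀ p₀ with hg₁
    have hc₀ : (⟨S.card + (t₀ : ℕ), by omega⟩ : Fin n) = c₀ := Fin.ext ht₀
    have hg₀t₀ : g₀ t₀ = r c₀ := by rw [hg₀]; simp only; rw [hc₀]
    have hne : g₀ ≠ g₁ := fun h => hp (by
      have := congrFun h t₀
      rw [hg₁, Function.update_self, hg₀t₀] at this
      exact this.symm)
    have hsurv : ∀ g : Fin m → Fin n,
        (∀ t : Fin m, g₀ t = g t ∨ (S.card + (t : ℕ) = c₀ ∧ g t = p₀)) ↔ (g = g₀ ∨ g = g₁) := by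
      intro g
      constructor
      · intro h
        by_cases hgt : g t₀ = p₀
        · right
          funext t
          by_cases htt : t = t₀
          · rw [htt, hgt, hg₁, Function.update_self]
          · rw [hg₁, Function.update_of_ne htt]
            rcases h t with h' | ⟨h1, -⟩
            · exact h'.symm
            · exact absurd (Fin.ext (by omega)) htt
        · left
          funext t
          rcases h t with h' | ⟨h1, h2⟩
          · exact h'.symm
          · have htt : t = t₀ := Fin.ext (by omega)
            rw [htt] at h2
            exact absurd h2 hgt
      · rintro (rfl | rfl) t
        · exact Or.inl rfl
        · by_cases htt : t = t₀
          · right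
            rw [htt, hg₁, Function.update_self]
            exact ⟨ht₀, rfl⟩
          · left
            rw [hg₁, Function.update_of_ne htt]
    simp_rw [hsurv]
    rw [← Finset.sum_subset (Finset.subset_univ ({g₀, g₁} : Finset (Fin m → Fin n)))
      (fun g _ hg => by
        have hg' : ¬ (g = g₀ ∨ g = g₁) := by simpa [Finset.mem_insert, Finset.mem_singleton] using hg
        rw [if_neg hg']; split_ifs <;> rfl),
      Finset.sum_pair hne]
    simp only [true_or, or_true, if_true]
    congr 1
    -- the second indicator: the only admissible `t⋆` is `t₀`
    by_cases hc : Function.Injective g₁ ∧ (∀ t : Fin m, g₁ t ∉ S) ∧ S ∪ univ.image g₁ = T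
    · rw [if_pos hc, if_pos ⟨t₀, ht₀, hp, hc⟩]
    · rw [if_neg hc, if_neg]
      rintro ⟨t₁, ht₁, -, hc₁⟩
      have : t₁ = t₀ := Fin.ext (by omega)
      subst this
      exact hc hc₁
  · -- only the word path survives
    have hsurv : ∀ g : Fin m → Fin n,
        (∀ t : Fin m, g₀ t = g t ∨ (S.card + (t : ℕ) = c₀ ∧ g t = p₀)) ↔ g = g₀ := by
      intro g
      constructor
      · intro h
        funext t
        rcases h t with h' | ⟨h1, h2⟩
        · exact h'.symm
        · by_cases hx3 : p₀ = r c₀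
          · rw [h2, hx3, hg₀]
            simp only
            congr 1
            exact Fin.ext (by simp only; omega)
          · exact absurd ⟨t, h1, hx3⟩ hx
      · rintro rfl t
        exact Or.inl rfl
    simp_rw [hsurv]
    rw [Finset.sum_eq_single_of_mem g₀ (Finset.mem_univ _) fun g _ hg => by rw [if_neg hg]; split_ifs <;> rfl,
      if_pos rfl]
    have hno : ¬ ∃ t₀ : Fin m, S.card + (t₀ : ℕ) = c₀ ∧ p₀ ≠ r c₀ ∧
        Function.Injective (Function.update g₀ t₀ p₀) ∧ (∀ t : Fin m, Function.update g₀ t₀ p₀ t ∉ S) ∧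
        S ∪ univ.image (Function.update g₀ t₀ p₀) = T := by
      rintro ⟨t₀, h1, h2, -⟩
      exact hx ⟨t₀, h1, h2⟩
    rw [if_neg hno, add_zero]

/-- **The path matrix at a word point with one extra cell**: `W S T` evaluates to the number of valid
paths `S → T` among the `r`-path of length `|T| - |S|` and its modification at the level `c⋆`.
[folklore] -/
theorem evalExtra_grenet_W (r : Fin n → Fin n) (p₀ : Fin n) (c₀ : Fin n) (S T : Finset (Fin n))
    (hST : S.card ≤ T.card) (hTn : T.card ≤ n) :
    eval (fun v : Fin n × Fin n => if r v.2 = v.1 ∨ (v.2 = c₀ ∧ v.1 = p₀) then (1 : k) else 0)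
        ((1 - Grenet.adj k n).adjugate S T)
      = (if Function.Injective (fun t : Fin (T.card - S.card) => r ⟨S.card + (t : ℕ), by omega⟩) ∧
            (∀ t : Fin (T.card - S.card), r ⟨S.card + (t : ℕ), by omega⟩ ∉ S) ∧
            S ∪ univ.image (fun t : Fin (T.card - S.card) => r ⟨S.card + (t : ℕ), by omega⟩) = T then 1 else 0) +
        (if ∃ t₀ : Fin (T.card - S.card), S.card + (t₀ : ℕ) = c₀ ∧ p₀ ≠ r c₀ ∧
            Function.Injective (Function.update (fun t : Fin (T.card - S.card) => r ⟨S.card + (t : ℕ), by omega⟩) t₀ p₀) ∧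
            (∀ t : Fin (T.card - S.card),
              Function.update (fun t : Fin (T.card - S.card) => r ⟨S.card + (t : ℕ), by omega⟩) t₀ p₀ t ∉ S) ∧
            S ∪ univ.image (Function.update (fun t : Fin (T.card - S.card) => r ⟨S.card + (t : ℕ), by omega⟩) t₀ p₀) = T
          then 1 else 0) := by
  rw [Grenet.adjugate_one_sub (Grenet.wt k n) (grenet_adj_shape k n), Matrix.sum_apply, map_sum,
    Finset.sum_eq_single_of_mem (T.card - S.card) (Finset.mem_range.mpr (by omega))]
  · exact evalExtra_grenet_adj_pow k r p₀ c₀ S T (by omega)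
  · intro m hm hne
    rw [eval_grenet_adj_pow]
    refine Finset.sum_eq_zero fun g _ => if_neg ?_
    rintro ⟨hg, hgS, hST'⟩
    have h := card_eq_of_pathCondition hg hgS hST'
    exact hne (by omega)

end Summit.ValiantsHypothesis.Theorems.RigidityForcesSymmetry.GrenetGauge
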